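import Mathlib
import HarnessLib
import HarnessLib.Audit
import Summits.AtomisticToContinuum.Statement

/-!
Route: SoftShoulderLandauDial

CLOSED (retired) 2026-08-15T13:46:43Z by operator:999:1257524 — reason: not-a-thesis: assembly does not conclude the sub-problem Statement — note: D-0027 §2.1 audit (human 2026-08-15: routes that do not decide the summit are removed): the assembly concludes `Literature.MathematicalPhysics.KineticTheory.HydrodynamicLimit`, not the sub-problem statement; a NEW conforming route may be opened from the same idea (generated `closes : … → _root_.Hydr. The file is kept as the record of this route; refuted decls are indexed as negative knowledge (`ledger negatives`).

# Route SoftShoulderLandauDial — soften the core, keep Newton — a Hamiltonian softness dial whose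
weak-coupling window gives ideal Euler at fixed volume fraction in d=3, climbing back to hard
spheres

X = DIAL EULER ("it suffices to show"): along the SOFTNESS DIAL of the conjunct's own particles —
N+1 penetrable spheres on 𝕋³ with pair potential
h·ψ(|x|/ε_N), ε_N = σ(N+1)^(-1/3) exactly as in the conjunct (fixed reduced density), ψ a C²
repulsive bump (flat core, range 1), Newtonian
deterministic dynamics, product local-Maxwellian data — the compressible Euler limit holds (i)
EXACTLY with the IDEAL-GAS law along every window
sequence N^(-1/6) ≪ h_N ≪ 1 (WindowEuler, card R0), (ii) to accuracy δ at every FIXED small height h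
< h₀(δ) (SmallHeightAccuracy, card R1), and
(iii) at the top of the dial h = ∞, which IS the conjunct (hard spheres, hard-sphere law). X is
deliberately STRONGER than the conjunct: the
route is a LADDER (realises card soft-shoulder-landau-dial); X → HydrodynamicLimit is projection,
the rungs are the cruxes, the middle of the
dial (fixed v ∈ (0,∞), card R2, informal item DialContinuity until the shoulder flow / soft EOS are
defined) is the declared bet.
Lean: `WindowEuler ∧ SmallHeightAccuracy ∧
Literature.MathematicalPhysics.KineticTheory.HydrodynamicLimit`

## Assembly
Frame only (ladder, D-0019; precedent MieLadderVdwKissing): DialEuler → HydrodynamicLimit is the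
projection onto the third conjunct (proved
sorry-free as `assembly_holds` in the folder's Sketch.lean, axioms
propext/Classical.choice/Quot.sound). The cruxes are the rungs BELOW the top:
WindowEuler (h_N → 0 in the window, exact, ideal law) → SmallHeightAccuracy (fixed small h, accuracy
δ) → [DialContinuity: fixed h ∈ (0,∞), exact,
penetrable-sphere law Z_(h/θ) — informal item until definitions land] → [FarEndIdentity: for the
square shoulder of height ≥ (N+1)²·θ̄ the shoulder
flow IS the hard-sphere flow on the bounded-energy event, so the top rung is the conjunct pathwise —
informal support]. Nothing below the top
implies the conjunct; the ladder's logical service is (1) a deterministic, Hamiltonian, d = 3,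
fixed-volume-fraction, Kn → 0 Euler target whose
only dynamical crux is CLT-shaped, (2) its cheapest litmus EquilibriumDecorrelation, (3) a
calibration of every closure engine on the board by
"does your small parameter survive h < ∞ and improve as h → 0?".

Rationale: WHY THIS LINE. Every smallness other routes borrow from outside Hamiltonian mechanics (OVY noise:
OllaVaradhanYau1993; randomised reflection laws; d → ∞) is
here manufactured by the Hamiltonian itself at fixed d = 3 and fixed volume fraction: lowering the
core height h turns the ≍ σ²N^(1/3) violent
collisions per unit time into as many gentle refractions with kicks O(h) → 0, so that in the window
N^(-1/6) ≪ h_N ≪ 1 the quadratic variation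
rate N^(1/3)h_N² still diverges (Kn_eff ≍ N^(-1/3)h_N^(-2) → 0) while every single kick vanishes —
the Lindeberg/martingale-CLT regime in which
the Stosszahlansatz becomes a central limit theorem (imported area: limit theorems for dependent
arrays and stochastic acceleration,
KestenPapanicolaou1980, KomorowskiRyzhik2006; weak-coupling/Landau kinetic theory,
BobylevPulvirentiSaffirio2013, Catapano2018,
NotaVelazquezWinter2021; Landau → compressible Euler by Hilbert expansion, arXiv:2209.15201). The
lower window edge h ≍ N^(-1/6) = (ε_N/σ)^(1/2)
is exactly the Bobylev–Pulvirenti–Saffirio/Spohn Landau scaling at unit density, so the window is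
the super-kinetic regime that
NotaVelazquezWinter2021 (p. 9) name and skip; nothing in print treats it, and no route or negative
on the board varies the pair potential.
What the line adds to the board: a typed deterministic-Hamiltonian Euler target at positive volume
fraction whose only dynamical crux is
CLT-shaped (WindowEuler), a one-particle equilibrium litmus of it (EquilibriumDecorrelation), a
calibration theorem (SoftLorentzIsotropisation),
and a Hamiltonian path h ↑ ∞ back to the conjunct on which each on-file closure engine can be asked
whether its small parameter survives.

RANKED CRUXES. #0 DialEuler (target) — X = WindowEuler ∧ SmallHeightAccuracy ∧ HydrodynamicLimit
(the window rung, asymptotic softness, and the top rung h = ∞ which is the conjunct verbatim);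
stronger than the conjunct by design (ladder). (why it might fail: contains the conjunct; and the
middle of the dial (fixed h) has no Lindeberg smallness — softness may not be asymptotically
harmless (SmallHeightAccuracy false) even if the window rung holds.) [Spohn1991,
OllaVaradhanYau1993, BobylevPulvirentiSaffirio2013, NotaVelazquezWinter2021]
#2 WindowEuler (crux) — WINDOW RUNG (card R0). For every C² antitone bump ψ (ψ = 1 on [0,1/2], ψ = 0
on [1,∞)), every height sequence h_N > 0 with h_N → 0 and h_N (N+1)^(1/6) → ∞, all continuous
profiles a₀, θ₀ > 0, u₀: ∃ σ₀ > 0 such that for σ < σ₀, every classical IDEAL-GAS Euler solution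
(IsHardSphereEulerSolution 0: p = ρθ, E = ρ(|u|²/2 + 3θ/2)) on [0,T), and every family Ψ_N of maps
solving Newton's equations for N+1 unit-mass particles on 𝕋³ with pair potential h_N ψ(|x|/ε_N), ε_N
= hsDiameter σ N (everywhere-defined, unique: bounded Lipschitz force): if under the product
local-Maxwellian law (canonicalDensity at diameter 0 of localGibbsProfile a₀ u₀ θ₀) the empirical
density/momentum/kinetic-energy fields converge in probability at t = 0 to (ρ, ρu, E)(0), then they
converge at every t < T to (ρ, ρu, E)(t). Foreseen children (layer 2): WeakCouplingChaos (card W1) →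
LandauRelaxationClosure (card W2) → WindowEuler. [difficulty: XL] (why it might fail: Needs
many-body weak-coupling chaos far beyond kinetic time (t/τ_relax ≍ N^(1/3)h² → ∞) at positive volume
fraction: re-encounter rings of relative weight O(ρσ³) per flight must stay summable in second
moments; plus velocity-tail control for the cubic energy flux.) [BobylevPulvirentiSaffirio2013,
Catapano2018, NotaVelazquezWinter2021, KestenPapanicolaou1980, Spohn1991, arXiv:2209.15201]
#4 EquilibriumDecorrelation (crux) — ONE-PARTICLE LITMUS OF WEAK-COUPLING CHAOS (typed special case
of card W1). Same bumps, same window, GLOBAL equilibrium product data (uniform positions, Maxwellian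
velocities at temperature θ̄): for σ < σ₀, every fixed macroscopic time t > 0 and all bounded
continuous f, g on ℝ³, Cov(f(v₀(0)), g(v₀(t))) → 0 for the tagged particle 0 — its velocity at a
fixed macroscopic time forgets its initial value (relaxation time τ ≍ N^(-1/3)h_N^(-2) → 0; momentum
conservation leaves only 3θ̄/(N+1); the hydrodynamic long-time tail is ≍ N^(-1/2)h³t^(-3/2) → 0).
Fails at the BPS edge h ≍ N^(-1/6) (τ = O(1)), so the window is sharp on this side. [difficulty: L]
(why it might fail: Even the LINEAR Landau equation from particles is proved only in the
intermediate scaling Nε² ≅ α → ∞ slowly (Catapano2018 §1.4), not at fixed Nε³; here in addition t ≫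
τ_relax, where correlated re-encounters at positive ρσ³ could leave an O(ρσ³) velocity memory.)
[Catapano2018, BobylevPulvirentiSaffirio2013, KomorowskiRyzhik2006, doi:10.2140/pmp.2021.2.27,
Spohn1991]
#5 SmallHeightAccuracy (crux) — ASYMPTOTIC SOFTNESS (card R1, accuracy form against ideal Euler).
Same bumps, profiles, product local-Maxwellian data and ideal Euler solution on [0,T) as in
WindowEuler; for σ < σ₀, every t < T, continuous χ and δ > 0 there is h₀ > 0 such that for every
FIXED height h ∈ (0, h₀) and the Newtonian flow at height h: exact convergence of the three fields
at t = 0 implies limsup_N P_N(|field_χ(t) − Euler field_χ(t)| > δ) ≤ δ for density, momentum and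
energy. (At fixed h the true equation of state is Z = 1 + O(ρσ³h/θ) and the internal energy 3θ/2 +
O(ρσ³h): O(h)-close to ideal, absorbed in δ by stability of classical solutions on [0,t].) [deps:
WindowEuler] [difficulty: open-problem] (why it might fail: At fixed h there is no Lindeberg
smallness: h⁻² kicks of size h per relaxation time is a penetrable-sphere Boltzmann–Enskog regime,
i.e. kinetic chaos at positive volume fraction of the same kind as the conjunct; soft repulsive
billiards also carry elliptic islands (RapoportRomkedarTuraev2007).) [Santos2005,
doi:10.1063/1.5119673, RapoportRomkedarTuraev2007, BobylevPulvirentiSaffirio2013, Spohn1991]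
#9 SoftLorentzIsotropisation (support) — CALIBRATION THEOREM (card R0-Lorentz / W4,
Kesten–Papanicolaou at positive scatterer volume fraction in the Euler window). One particle from
(x₀, v₀ ≠ 0) among N+1 i.i.d. uniform FROZEN bump scatterers h_N ψ(|x − c_k|/ε_N) on 𝕋³, ε_N =
hsDiameter σ N, σ < 1/2, window heights: at every fixed t > 0, annealed over the scatterers, the
speed → |v₀| and the position → x₀ in probability, and the law of the velocity becomes
asymptotically invariant under every linear isometry of ℝ³ (uniform on the sphere |v| = |v₀|).
Bookkeeping: relaxation time τ ≍ N^(-1/3)h⁻², explored radius ≍ N^(-1/6)h⁻¹ → 0 containing ≍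
N^(1/2)h⁻³ → ∞ scatterers (⇔ window), re-encounter fraction ≍ N^(-1/6)h³ → 0.
Stochastic-acceleration technology (KestenPapanicolaou1980 d ≥ 3; KomorowskiRyzhik2006 for t ≫
kinetic time) in a joint small-scatterer limit; the one-body half of WindowEuler's local
equilibration. [difficulty: L] [KestenPapanicolaou1980, KomorowskiRyzhik2006,
doi:10.1039/c9sm00442d, Catapano2018]

TWO-LAYER PLAN. Foreseen glued splits (k ≤ 3, depth 1), none filed now. WindowEuler ⇐
WeakCouplingChaos (card W1: over a randomisation window
[s, s + K·N^(-1/3)h_N^(-2)] the kicks a tagged particle receives from its ≍ h_N^(-2) distinct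
partners form, given the past, a martingale-difference
array up to a predictable drift, with conditional drift/covariance within o(1) of the Landau
coefficients of the local empirical velocity law;
filed informally at open as the rank-3 crux) → LandauRelaxationClosure (card W2: Landau entropy
production with coercivity uniform in the local
state relaxes the window-averaged velocity law to the local Maxwellian, so kinetic stress is
isotropic, heat flux and collisional transfer are
o(1), potential energy O(ρσ³h_N) → 0; then mean ⇒ probability by an observable-level closing) →
WindowEuler. EquilibriumDecorrelation ⇐
LinearLandauFixedFraction (Catapano's theorem moved from Nε² ≅ α to fixed Nε³ on kinetic windows) →
LongTimeExtension (t/τ → ∞ à la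
Komorowski–Ryzhik / BGSR diffusive times) → EquilibriumDecorrelation. SmallHeightAccuracy ⇐
EnskogLandauExpansion (O(h)-accurate kinetic
description at fixed small h) → EulerEosStability (classical solutions depend continuously on the
law on [0,t]) → SmallHeightAccuracy.

KILL CRITERIA. EquilibriumDecorrelation refuted (a residual velocity memory at fixed macroscopic
time inside the window, e.g. from re-encounter rings at
positive ρσ³) kills the CLT engine at positive volume fraction even at weak coupling: close
`refuted:EquilibriumDecorrelation` and hand the
witness to maxwellian-clt-collision-isometries / large-dimension-ladder as negative knowledge.
WindowEuler refuted with EquilibriumDecorrelation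
standing ⇒ the failure is in the closure/energy-tail step: pivot WindowEuler to its accuracy-δ or
isothermal-window form (restate, same decl).
SmallHeightAccuracy refuted ⇒ softness is not asymptotically harmless and the dial has no continuous
middle: restate the Target as
WindowEuler ∧ HydrodynamicLimit and retire DialContinuity; if in addition WindowEuler is refuted,
close the route `refuted:WindowEuler`.
HydrodynamicLimit proved elsewhere moots only Target/Assembly; WindowEuler and
SoftLorentzIsotropisation stay wanted as Literature-side theorems.

NOT DECOMPOSED YET. The children W1/W2 of WindowEuler and the Landau coefficient A[ψ] (an explicit
impact-parameter integral, finite: no Coulomb logarithm for a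
finite-range bump); velocity-tail / moment bounds along the soft flow (the shared a-priori input of
every route — here mitigated: a fast particle
is deflected by O(h/|g|²), less); the fixed-h rungs R2 = DialContinuity and the far-end identity
(definition requests below); rates; the
square-shoulder (event-driven) versions of the typed rungs, whose reflection channel has
flux-weighted probability O(h/θ) and kicks ≤ 2(hθ)^(1/2);
d = 2; attractive wells (penetrable square well, doi:10.1063/1.5119673). All wait for
EquilibriumDecorrelation or WindowEuler to move.

CHEAPEST FALSIFIER. Pen and paper first: (i) the flux-weighted distribution of single-encounter
kicks for the bump at height h — the Lindeberg claim is that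
encounters with |Δv| > η√θ have flux fraction O((h/θ)²/η⁴) (only pairs with relative speed ≲
(h)^(1/2) reflect) while the quadratic variation is
≍ ν_e h²/θ; a positive fraction of quadratic variation from O(1) kicks would kill WindowEuler's
engine; (ii) the h → 0 limit of the
penetrable-sphere Boltzmann kernel (Santos2005): a NON-Landau O(1) remainder in the weak form kills
LandauRelaxationClosure (a merely
log-divergent coefficient only shifts the window). Then one kit MD job: N ≈ 10⁴–10⁵ bump particles
at ρσ³ = 0.05, h/θ ∈ {0.03, 0.1, 0.3, 1, 3}:
the velocity-autocorrelation decay rate must scale like ν_e(h/θ)² for small h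
(EquilibriumDecorrelation's bookkeeping) and cross over to the
Enskog rate for large h. Not run here (planner seat; no kit in plancard mode).

NUMBERS. Encounter rate per particle ν_e ≍ πσ²(N+1)^(1/3)·ḡ (ḡ ≍ θ^(1/2)); transmitted kick |Δv| ≍
h/ḡ; quadratic-variation rate ≍ ν_e h²/θ; velocity
relaxation time τ ≍ N^(-1/3)(h/θ)^(-2)σ^(-2)θ^(-1/2); window N^(-1/6)σ^(-1) ≪ h/θ ≪ 1, lower edge =
BPS/Spohn Landau scaling (potential × ε^(1/2),
ε_N = σN^(-1/3): BobylevPulvirentiSaffirio2013 p. 5); Kn_eff ≍ N^(-1/3)(h/θ)^(-2)σ^(-2); potential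
energy per particle O(ρσ³h); second virial
coefficient of the shoulder B₂ = (2π/3)ε³(1 − e^(−V₀/θ)); hydrodynamic VACF tail ≍
N^(-1/2)(h/θ)³t^(-3/2); Lorentz anchor: explored radius
≍ N^(-1/6)(h/θ)^(-1), scatterers inside ≍ N^(1/2)(h/θ)^(-3), re-encounter fraction ≍ N^(-1/6)(h/θ)³.
Items at open: 6 typed (target, 3 cruxes,
1 support, assembly) + 4 informal filed right after open (WeakCouplingChaos crux 3, DialContinuity
crux 6, FarEndIdentity support,
ShoulderKinetics support) = 10.

DEFINITION REQUESTS. (D1) `SoftSphereFlow G W ε N` (Literature/Analysis/FunctionSpaces, next to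
PotentialDynamics): the everywhere-defined Newtonian flow of N unit-mass
particles on a Geometry with a BOUNDED C² radial pair potential W(·/ε) — the typed rungs inline its
three axioms (Ψ 0 = id, v̇_i = −Σ_j ∇W_ε(sepVec
x_i x_j), x_i(t) = translate x_i(0) ∫₀ᵗ v_i) and should be restated over it;
`Kinetic.ShortRangePotential` cannot host it (its profile → +∞ at 0⁺).
(D2) `SquareShoulderFlow G V₀ ε N` (Literature/Analysis/FluidPDE, next to HardSphereDynamics): the
a.e.-defined event-driven flow for the step
potential V₀·1(r < ε) — free flight, refraction in/out when the normal relative energy exceeds V₀,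
specular reflection otherwise — with its
Alexander-type existence; needed by DialContinuity and FarEndIdentity (V₀ = ∞ is HardSphereFlow).
(D3) `pairPotentialFreeEnergy / Pressure /
InternalEnergy` and `IsPairPotentialEulerSolution` (Literature/MathematicalPhysics/KineticTheory,
next to hsExcessFreeEnergy /
IsHardSphereEulerSolution): thermodynamics of a bounded repulsive pair potential at reduced range σ
and the compressible Euler system with that
law (internal energy now has a potential part); needed by DialContinuity.

Novelty: Searches (2026-08-15; local index rc 1 = searchd reset, arXiv/OpenAlex HTTP 429, galaxy saturated —
logged in NOTES.md): zbmath "weak coupling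
limit Landau equation particles" (8: BobylevPulvirentiSaffirio2013, Catapano2018, Le Bihan–Winter
doi:10.3934/krm.2023003, Feliachi–Bouchet
doi:10.1007/s10955-021-02771-9); zbmath "Landau equation hydrodynamic limit compressible Euler" (7:
doi:10.1007/s00205-021-01642-7,
arXiv:2209.15201, arXiv:2511.03033); zbmath "limit theorem for stochastic acceleration"
(KestenPapanicolaou1980, Dürr 1985 zbl:0566.60028);
zbmath "Komorowski Ryzhik" (KomorowskiRyzhik2006); zbmath "Nota Winter long range kinetic"
(NotaVelazquezWinter2021, doi:10.4171/rlm/977); zbmath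
"Lenard Balescu Duerinckx" (doi:10.2140/pmp.2021.2.27, arXiv:2511.10778); crossref
"penetrable-sphere model" (Santos2005, doi:10.1063/1.5119673,
doi:10.1039/c9sm00442d); `lit read arXiv:1701.05465` p. 4 (Catapano: intermediate scaling Nε² ≅ α,
"the rigorous derivation of Landau equation
is still open even for short times"); the card's crossref/galaxy searches and the refuter audit's
reads (arXiv:1207.5987 p. 5, arXiv:2003.11605
p. 9); the 8 route files and 135 cards of the sub (no other card varies the pair potential; weak
coupling appears only inside
large-dimension-ladder / hilbert-six-in-log-dimensions as d → ∞ physics).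
Nearest prior art found: BobylevPulvirentiSaffirio2013 (weak coupling at unit density = fixed volume
fraction, kinetic time, consistency only);
Catapano2018 (linear La  [refs: 10.3934/krm.2023003, 10.1007/s10955-021-02771-9, 10.1007/s00205-021-01642-7, 10.4171/rlm/977, 10.2140/pmp.2021.2.27, 10.1063/1.5119673, 10.1039/c9sm00442d, 2209.15201, 2511.03033, 2511.10778, 1701.05465, 1207.5987, 2003.11605, doi:10.3934/krm.2023003, doi:10.1007/s10955-021-02771-9, doi:10.1007/s00205-021-01642-7, doi:10.4171/rlm/977, doi:10.2140/pmp.2021.2.27, doi:10.1063/1.5119673, doi:10.1039/c]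

Barriers (technique_class: weak-coupling-dial, martingale-clt, landau-regime): - technique_class: weak-coupling-dial, martingale-clt, landau-regime
- Literature.Barriers.AtomisticToContinuum.DiluteRegimeBarrier: WindowEuler's TARGET law is ideal
(met in substance, stated plainly), but its kernel is not: (N+1)ε³ = σ³ is fixed, no Boltzmann–Grad
or admissible joint limit is taken, Kn_eff is a power of N and no Boltzmann equation is derived; the
dial separates "ideal law" (cheap: potential energy O(ρσ³h) → 0) from "dilute geometry" (Lanford's
crutch), and the top rung carries the full hard-sphere law.
- Literature.Barriers.AtomisticToContinuum.BoltzmannHypothesisBarrier: no classification of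
stationary states is used; the ergodic input is a martingale-CLT for kicks from distinct partners
(WeakCouplingChaos / EquilibriumDecorrelation); the barrier's ideal-gas witness sits at the dial's
END POINT h = 0 where ν_e h² = 0, and the window is bounded away from it by N^(1/3)h_N² → ∞ —
exactly the quantity the witness lacks (BoltzmannHypothesisBarrierNarrow likewise: no flux-level
Gibbs closure through the classification).
- Literature.Barriers.AtomisticToContinuum.NoDensityExpansionBarrier: no density (virial) series of
a transport coefficient; Euler order needs none, and the weak-coupling expansion in h has a finite
Landau coefficient for a finite-range bump.
- Literature.Barriers.AtomisticToContinuum.HighMomentumCutoffBarrier: it does not evade it; the bet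
is that the cubic energy flux is controlled along the soft flow by the same a-priori tail input
every route

History (route lifecycle, newest last):
- 2026-08-15T12:00:56Z · rev 1: restated DialEuler (stmt-AtomisticToContinuum-5479) — materialise target: DialEuler restated with WindowEuler and SmallHeightAccuracy inlined (definitionally equal, Iff.rfl checked) because the gate renders the ran (planner-plancard-AtomisticToContinuum-Hydrody-50d41d34-0)
- 2026-08-15T12:07:06Z · rev 2: restated Assembly (stmt-AtomisticToContinuum-5484) — materialise assembly now that DialEuler (stmt-7067) has landed; the gate requires a changed term, so the (redundant, harmless) antecedent WindowEuler is added: (planner-plancard-AtomisticToContinuum-Hydrody-50d41d34-0)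
- 2026-08-15T13:46:43Z · CLOSED retired — not-a-thesis: assembly does not conclude the sub-problem Statement (operator:999:1257524)

sub-problem: HydrodynamicLimit · status: closed(retired) · opened planner-plancard-AtomisticToContinuum-Hydrody-50d41d34-0 2026-08-15T11:41:18Z · rev 3 · ledger route-AtomisticToContinuum-SoftShoulderLandauDial
GENERATED by the gate from the ledger (D-0016/17). Provers cite these decls: `theorem foo : Summit.AtomisticToContinuum.HydrodynamicLimit.Theses.SoftShoulderLandauDial.<Decl> := …` in Summits/AtomisticToContinuum/HydrodynamicLimit/Theorems/<Name>.lean.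
-/

namespace Summit.AtomisticToContinuum.HydrodynamicLimit.Theses.SoftShoulderLandauDial

open scoped BigOperators Topology Manifold Classical MeasureTheory ProbabilityTheory Matrix InnerProductSpace ComplexConjugate ContinuousMap
open Filter Set Function TopologicalSpace MeasureTheory

attribute [summit_statement] _root_.HydrodynamicLimit

-- earlier DialEuler (stmt-AtomisticToContinuum-5479, replaced 2026-08-15T12:00:56Z -> stmt-AtomisticToContinuum-7067): retired by None — WindowEuler ∧ SmallHeightAccuracy ∧ Literature.MathematicalPhysics.KineticTheory.HydrodynamicLimit
/-- item stmt-AtomisticToContinuum-7067 · target · rank 0 · closed · moot by None · by planner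
why it might fail: contains the conjunct; and the middle of the dial (fixed h) has no Lindeberg smallness — softness may not be asymptotically harmless (SmallHeightAccuracy false) even if the window rung holds.
sources: Spohn1991, OllaVaradhanYau1993, BobylevPulvirentiSaffirio2013, NotaVelazquezWinter2021
[target] X = WindowEuler ∧ SmallHeightAccuracy ∧ HydrodynamicLimit (the window rung, asymptotic
softness, and the top rung h = ∞ which is the conjunct verbatim); stronger than the conjunct by
design (ladder). -/
@[route_item "route-AtomisticToContinuum-SoftShoulderLandauDial"]
def DialEuler : Prop :=
  (open Literature.MathematicalPhysics.KineticTheory Literature.Analysis.FluidPDE in ∀ (ψ : ℝ → ℝ), ContDiff ℝ 2 ψ → Antitone ψ → (∀ r, r ≤ 2⁻¹ → ψ r = 1) → (∀ r, 1 ≤ r → ψ r = 0) → ∀ (h : ℕ → ℝ), (∀ N, 0 < h N) → Tendsto h atTop (𝓝 0) → Tendsto (fun N => h N * ((N + 1 : ℕ) : ℝ) ^ (6 : ℝ)⁻¹) atTop atTop → ∀ (a₀ θ₀ : T3 → ℝ) (u₀ : T3 → V3), Continuous a₀ → Continuous θ₀ → Continuous u₀ → (∀ x, 0 < a₀ x)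 → (∀ x, 0 < θ₀ x) → ∃ σ₀ : ℝ, 0 < σ₀ ∧ ∀ σ : ℝ, 0 < σ → σ < σ₀ → ∀ (T : ℝ) (ρ θ : ℝ → T3 → ℝ) (u : ℝ → T3 → V3), IsHardSphereEulerSolution 0 T ρ u θ → ∀ Ψ : (N : ℕ) → ℝ → Config (N + 1) (Fin 3) T3 → Config (N + 1) (Fin 3) T3, (∀ (N : ℕ) (z : Config (N + 1) (Fin 3) T3), Ψ N 0 z = z ∧ ∀ (t : ℝ) (i : Fin (N + 1)), HasDerivAt (fun s => (Ψ N s z i).2) (-∑ j ∈ Finset.univ.erase i, gradient (fun x : V3 => h N * ψ (‖x‖ / hsDiameter σ N)) ((Torus.geometry (Fin 3)).sepVec (Ψ N t z i).1 (Ψ N t z j).1)) t ∧ (Ψ N t z i).1 = (Torus.geometry (Fin 3)).translate (z i).1 (∫ s in (0 : ℝ)..t, (Ψ N s z i).2)) → let P : (N : ℕ) → Measure (Config (N + 1) (Fin 3) T3) := fun N => volume.withDensity (fun z => ENNReal.ofReal (canonicalDensity (Torus.geometry (Fin 3)) 0 (N + 1) (localGibbsProfile a₀ u₀ θ₀) z));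 let Conv : ℝ → Prop := fun t => ∀ χ : T3 → ℝ, Continuous χ → ∀ δ : ℝ, 0 < δ → Tendsto (fun N => P N {z | δ < |empiricalDensityField (Ψ N t z) χ - ∫ x, χ x * ρ t x|}) atTop (𝓝 0) ∧ Tendsto (fun N => P N {z | δ < ‖empiricalMomentumField (Ψ N t z) χ - ∫ x, (χ x * ρ t x) • u t x‖}) atTop (𝓝 0) ∧ Tendsto (fun N => P N {z | δ < |empiricalEnergyField (Ψ N t z) χ - ∫ x, χ x * totalEnergyDensity (ρ t x) (u t x) (θ t x)|}) atTop (𝓝 0); (∀ N, IsProbabilityMeasure (P N)) → Conv 0 → ∀ t ∈ Ico 0 T, Conv t) ∧ (open Literature.MathematicalPhysics.KineticTheory Literature.Analysis.FluidPDE in ∀ (ψ : ℝ → ℝ), ContDiff ℝ 2 ψ → Antitone ψ → (∀ r, r ≤ 2⁻¹ → ψ r = 1) → (∀ r, 1 ≤ r → ψ r = 0) → ∀ (a₀ θ₀ : T3 → ℝ) (u₀ : T3 → V3), Continuous a₀ → Continuous θ₀ → Continuous u₀ → (∀ x, 0 < a₀ x) → (∀ x, 0 < θ₀ x) → ∃ σ₀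 : ℝ, 0 < σ₀ ∧ ∀ σ : ℝ, 0 < σ → σ < σ₀ → ∀ (T : ℝ) (ρ θ : ℝ → T3 → ℝ) (u : ℝ → T3 → V3), IsHardSphereEulerSolution 0 T ρ u θ → ∀ t ∈ Ico 0 T, ∀ χ : T3 → ℝ, Continuous χ → ∀ δ : ℝ, 0 < δ → ∃ h₀ : ℝ, 0 < h₀ ∧ ∀ hgt : ℝ, 0 < hgt → hgt < h₀ → ∀ Ψ : (N : ℕ) → ℝ → Config (N + 1) (Fin 3) T3 → Config (N + 1) (Fin 3) T3, (∀ (N : ℕ) (z : Config (N + 1) (Fin 3) T3), Ψ N 0 z = z ∧ ∀ (s' : ℝ) (i : Fin (N + 1)), HasDerivAt (fun s => (Ψ N s z i).2) (-∑ j ∈ Finset.univ.erase i, gradient (fun x : V3 => hgt * ψ (‖x‖ / hsDiameter σ N)) ((Torus.geometry (Fin 3)).sepVec (Ψ N s' z i).1 (Ψ N s' z j).1)) s' ∧ (Ψ N s' z i).1 = (Torus.geometry (Fin 3)).translate (z i).1 (∫ s in (0 : ℝ)..s', (Ψ N s z i).2)) → let P : (N : ℕ) → Measure (Config (N + 1)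 (Fin 3) T3) := fun N => volume.withDensity (fun z => ENNReal.ofReal (canonicalDensity (Torus.geometry (Fin 3)) 0 (N + 1) (localGibbsProfile a₀ u₀ θ₀) z)); (∀ N, IsProbabilityMeasure (P N)) → (∀ χ' : T3 → ℝ, Continuous χ' → ∀ δ' : ℝ, 0 < δ' → Tendsto (fun N => P N {z | δ' < |empiricalDensityField z χ' - ∫ x, χ' x * ρ 0 x|}) atTop (𝓝 0) ∧ Tendsto (fun N => P N {z | δ' < ‖empiricalMomentumField z χ' - ∫ x, (χ' x * ρ 0 x) • u 0 x‖}) atTop (𝓝 0) ∧ Tendsto (fun N => P N {z | δ' < |empiricalEnergyField z χ' - ∫ x, χ' x * totalEnergyDensity (ρ 0 x) (u 0 x) (θ 0 x)|}) atTop (𝓝 0)) → limsup (fun N => P N {z | δ < |empiricalDensityField (Ψ N t z) χ - ∫ x, χ x * ρ t x|}) atTop ≤ ENNReal.ofReal δ ∧ limsup (fun N => P N {z | δ < ‖empiricalMomentumField (Ψ N t z) χ - ∫ x, (χ x * ρ t x) • u t x‖}) atTop ≤ ENNReal.ofReal δ ∧ limsup (fun N => P N {z | δ < |empiricalEnergyField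 (Ψ N t z) χ - ∫ x, χ x * totalEnergyDensity (ρ t x) (u t x) (θ t x)|}) atTop ≤ ENNReal.ofReal δ) ∧ Literature.MathematicalPhysics.KineticTheory.HydrodynamicLimit

/-- item stmt-AtomisticToContinuum-5480 · crux · rank 2 · closed · moot by None · by planner
why it might fail: Needs many-body weak-coupling chaos far beyond kinetic time (t/τ_relax ≍ N^(1/3)h² → ∞) at positive volume fraction: re-encounter rings of relative weight O(ρσ³) per flight must stay summable in second moments; plus velocity-tail control for the cubic energy flux.
sources: BobylevPulvirentiSaffirio2013, Catapano2018, NotaVelazquezWinter2021, KestenPapanicolaou1980, Spohn1991, arXiv:2209.15201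
[crux] WINDOW RUNG (card R0). For every C² antitone bump ψ (ψ = 1 on [0,1/2], ψ = 0 on [1,∞)), every
height sequence h_N > 0 with h_N → 0 and h_N (N+1)^(1/6) → ∞, all continuous profiles a₀, θ₀ > 0,
u₀: ∃ σ₀ > 0 such that for σ < σ₀, every classical IDEAL-GAS Euler solution
(IsHardSphereEulerSolution 0: p = ρθ, E = ρ(|u|²/2 + 3θ/2)) on [0,T), and every family Ψ_N of maps
solving Newton's equations for N+1 unit-mass particles on 𝕋³ with pair potential h_N ψ(|x|/ε_N), ε_N
= hsDiameter σ N (everywhere-defined, unique: bounded Lipschitz force): if under the product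
local-Maxwellian law (canonicalDensity at diameter 0 of localGibbsProfile a₀ u₀ θ₀) the empirical
density/momentum/kinetic-energy fields converge in probability at t = 0 to (ρ, ρu, E)(0), then they
converge at every t < T to (ρ, ρu, E)(t). Foreseen children (layer 2): WeakCouplingChaos (card W1) →
LandauRelaxationClosure (card W2) → WindowEuler. [difficulty: XL] -/
@[route_item "route-AtomisticToContinuum-SoftShoulderLandauDial"]
def WindowEuler : Prop :=
  open Literature.MathematicalPhysics.KineticTheory Literature.Analysis.FluidPDE in ∀ (ψ : ℝ → ℝ), ContDiff ℝ 2 ψ → Antitone ψ → (∀ r, r ≤ 2⁻¹ → ψ r = 1) → (∀ r, 1 ≤ r → ψ r = 0) → ∀ (h : ℕ → ℝ), (∀ N, 0 < h N) → Tendsto h atTop (𝓝 0) → Tendsto (fun N => h N * ((N + 1 : ℕ) : ℝ) ^ (6 : ℝ)⁻¹) atTop atTop → ∀ (a₀ θ₀ : T3 → ℝ) (u₀ : T3 → V3), Continuous a₀ → Continuous θ₀ → Continuous u₀ → (∀ x, 0 < a₀ x) → (∀ x, 0 < θ₀ x) → ∃ σ₀ : ℝ, 0 < σ₀ ∧ ∀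 σ : ℝ, 0 < σ → σ < σ₀ → ∀ (T : ℝ) (ρ θ : ℝ → T3 → ℝ) (u : ℝ → T3 → V3), IsHardSphereEulerSolution 0 T ρ u θ → ∀ Ψ : (N : ℕ) → ℝ → Config (N + 1) (Fin 3) T3 → Config (N + 1) (Fin 3) T3, (∀ (N : ℕ) (z : Config (N + 1) (Fin 3) T3), Ψ N 0 z = z ∧ ∀ (t : ℝ) (i : Fin (N + 1)), HasDerivAt (fun s => (Ψ N s z i).2) (-∑ j ∈ Finset.univ.erase i, gradient (fun x : V3 => h N * ψ (‖x‖ / hsDiameter σ N)) ((Torus.geometry (Fin 3)).sepVec (Ψ N t z i).1 (Ψ N t z j).1)) t ∧ (Ψ N t z i).1 = (Torus.geometry (Fin 3)).translate (z i).1 (∫ s in (0 : ℝ)..t, (Ψ N s z i).2)) → let P : (N : ℕ) → Measure (Config (N + 1) (Fin 3) T3) := fun N => volume.withDensity (fun z => ENNReal.ofReal (canonicalDensity (Torus.geometry (Fin 3)) 0 (N + 1) (localGibbsProfile a₀ u₀ θ₀) z)); let Conv : ℝ → Prop := fun t => ∀ χ : T3 → ℝ, Continuous χ → ∀ δ : ℝ,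 0 < δ → Tendsto (fun N => P N {z | δ < |empiricalDensityField (Ψ N t z) χ - ∫ x, χ x * ρ t x|}) atTop (𝓝 0) ∧ Tendsto (fun N => P N {z | δ < ‖empiricalMomentumField (Ψ N t z) χ - ∫ x, (χ x * ρ t x) • u t x‖}) atTop (𝓝 0) ∧ Tendsto (fun N => P N {z | δ < |empiricalEnergyField (Ψ N t z) χ - ∫ x, χ x * totalEnergyDensity (ρ t x) (u t x) (θ t x)|}) atTop (𝓝 0); (∀ N, IsProbabilityMeasure (P N)) → Conv 0 → ∀ t ∈ Ico 0 T, Conv t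

-- item stmt-AtomisticToContinuum-6918 · crux · rank 3 · closed · moot by None · by planner — informal only, no Lean statement yet:
--   [crux] WEAK-COUPLING CHAOS AT POSITIVE VOLUME FRACTION over Euler windows (card
--   soft-shoulder-landau-dial W1; foreseen child of WindowEuler). Setting of WindowEuler (bumps h_N
--   psi(|x|/eps_N), window N^(-1/6) << h_N << 1, sigma < sigma_0, product local-Maxwellian data, t < T).
--   For a tagged particle, conditionally on the past, the velocity kicks received over a randomisation
--   window [s, s + K N^(-1/3) h_N^(-2)] from its ~ h_N^(-2) DISTINCT partners form a
--   martingale-difference array up to a predictable drift, with conditional drift/covariance within o(1)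
--   of the Landau coefficients A[g_{s,x}], B[g

/-- item stmt-AtomisticToContinuum-5481 · crux · rank 4 · closed · moot by None · by planner
why it might fail: Even the LINEAR Landau equation from particles is proved only in the intermediate scaling Nε² ≅ α → ∞ slowly (Catapano2018 §1.4), not at fixed Nε³; here in addition t ≫ τ_relax, where correlated re-encounters at positive ρσ³ could leave an O(ρσ³) velocity memory.
sources: Catapano2018, BobylevPulvirentiSaffirio2013, KomorowskiRyzhik2006, doi:10.2140/pmp.2021.2.27, Spohn1991
[crux] ONE-PARTICLE LITMUS OF WEAK-COUPLING CHAOS (typed special case of card W1). Same bumps, same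
window, GLOBAL equilibrium product data (uniform positions, Maxwellian velocities at temperature
θ̄): for σ < σ₀, every fixed macroscopic time t > 0 and all bounded continuous f, g on ℝ³,
Cov(f(v₀(0)), g(v₀(t))) → 0 for the tagged particle 0 — its velocity at a fixed macroscopic time
forgets its initial value (relaxation time τ ≍ N^(-1/3)h_N^(-2) → 0; momentum conservation leaves
only 3θ̄/(N+1); the hydrodynamic long-time tail is ≍ N^(-1/2)h³t^(-3/2) → 0). Fails at the BPS edge
h ≍ N^(-1/6) (τ = O(1)), so the window is sharp on this side. [difficulty: L] -/
@[route_item "route-AtomisticToContinuum-SoftShoulderLandauDial"]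
def EquilibriumDecorrelation : Prop :=
  open Literature.MathematicalPhysics.KineticTheory Literature.Analysis.FluidPDE in ∀ (ψ : ℝ → ℝ), ContDiff ℝ 2 ψ → Antitone ψ → (∀ r, r ≤ 2⁻¹ → ψ r = 1) → (∀ r, 1 ≤ r → ψ r = 0) → ∀ (h : ℕ → ℝ), (∀ N, 0 < h N) → Tendsto h atTop (𝓝 0) → Tendsto (fun N => h N * ((N + 1 : ℕ) : ℝ) ^ (6 : ℝ)⁻¹) atTop atTop → ∀ θbar : ℝ, 0 < θbar → ∃ σ₀ : ℝ, 0 < σ₀ ∧ ∀ σ : ℝ, 0 < σ → σ < σ₀ → ∀ Ψ : (N : ℕ) → ℝ → Config (N + 1) (Fin 3) T3 → Config (N + 1) (Fin 3) T3, (∀ (N : ℕ) (z : Config (N + 1) (Fin 3) T3), Ψ N 0 z = z ∧ ∀ (t : ℝ) (i : Fin (N + 1)), HasDerivAt (fun s => (Ψ N s z i).2) (-∑ j ∈ Finset.univ.erase i, gradient (fun x : V3 => h N * ψ (‖x‖ / hsDiameter σ N)) ((Torus.geometry (Fin 3)).sepVec (Ψ N t z i).1 (Ψ N t z j).1)) t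 ∧ (Ψ N t z i).1 = (Torus.geometry (Fin 3)).translate (z i).1 (∫ s in (0 : ℝ)..t, (Ψ N s z i).2)) → let P : (N : ℕ) → Measure (Config (N + 1) (Fin 3) T3) := fun N => volume.withDensity (fun z => ENNReal.ofReal (canonicalDensity (Torus.geometry (Fin 3)) 0 (N + 1) (localGibbsProfile (fun _ => 1) (fun _ => 0) (fun _ => θbar)) z)); (∀ N, IsProbabilityMeasure (P N)) → ∀ t : ℝ, 0 < t → ∀ f g : BoundedContinuousFunction V3 ℝ, Tendsto (fun N => (∫ z, f ((z 0).2) * g ((Ψ N t z 0).2) ∂P N) - (∫ z, f ((z 0).2) ∂P N) * (∫ z, g ((Ψ N t z 0).2) ∂P N)) atTop (𝓝 0)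

/-- item stmt-AtomisticToContinuum-5482 · crux · rank 5 · closed · moot by None · by planner
why it might fail: At fixed h there is no Lindeberg smallness: h⁻² kicks of size h per relaxation time is a penetrable-sphere Boltzmann–Enskog regime, i.e. kinetic chaos at positive volume fraction of the same kind as the conjunct; soft repulsive billiards also carry elliptic islands (RapoportRomkedarTuraev2007).
sources: Santos2005, doi:10.1063/1.5119673, RapoportRomkedarTuraev2007, BobylevPulvirentiSaffirio2013, Spohn1991
[crux] ASYMPTOTIC SOFTNESS (card R1, accuracy form against ideal Euler). Same bumps, profiles,
product local-Maxwellian data and ideal Euler solution on [0,T) as in WindowEuler; for σ < σ₀, every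
t < T, continuous χ and δ > 0 there is h₀ > 0 such that for every FIXED height h ∈ (0, h₀) and the
Newtonian flow at height h: exact convergence of the three fields at t = 0 implies limsup_N
P_N(|field_χ(t) − Euler field_χ(t)| > δ) ≤ δ for density, momentum and energy. (At fixed h the true
equation of state is Z = 1 + O(ρσ³h/θ) and the internal energy 3θ/2 + O(ρσ³h): O(h)-close to ideal,
absorbed in δ by stability of classical solutions on [0,t].) [deps: WindowEuler] [difficulty:
open-problem] -/
@[route_item "route-AtomisticToContinuum-SoftShoulderLandauDial"]
def SmallHeightAccuracy : Prop :=
  open Literature.MathematicalPhysics.KineticTheory Literature.Analysis.FluidPDE in ∀ (ψ : ℝ → ℝ), ContDiff ℝ 2 ψ → Antitone ψ → (∀ r, r ≤ 2⁻¹ → ψ r = 1) → (∀ r, 1 ≤ r → ψ r = 0) → ∀ (a₀ θ₀ : T3 → ℝ) (u₀ : T3 → V3), Continuous a₀ → Continuous θ₀ → Continuous u₀ → (∀ x, 0 < a₀ x) → (∀ x, 0 < θ₀ x) → ∃ σ₀ : ℝ, 0 < σ₀ ∧ ∀ σ : ℝ, 0 < σ → σ < σ₀ → ∀ (T : ℝ)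 (ρ θ : ℝ → T3 → ℝ) (u : ℝ → T3 → V3), IsHardSphereEulerSolution 0 T ρ u θ → ∀ t ∈ Ico 0 T, ∀ χ : T3 → ℝ, Continuous χ → ∀ δ : ℝ, 0 < δ → ∃ h₀ : ℝ, 0 < h₀ ∧ ∀ hgt : ℝ, 0 < hgt → hgt < h₀ → ∀ Ψ : (N : ℕ) → ℝ → Config (N + 1) (Fin 3) T3 → Config (N + 1) (Fin 3) T3, (∀ (N : ℕ) (z : Config (N + 1) (Fin 3) T3), Ψ N 0 z = z ∧ ∀ (s' : ℝ) (i : Fin (N + 1)), HasDerivAt (fun s => (Ψ N s z i).2) (-∑ j ∈ Finset.univ.erase i, gradient (fun x : V3 => hgt * ψ (‖x‖ / hsDiameter σ N)) ((Torus.geometry (Fin 3)).sepVec (Ψ N s' z i).1 (Ψ N s' z j).1)) s' ∧ (Ψ N s' z i).1 = (Torus.geometry (Fin 3)).translate (z i).1 (∫ s in (0 : ℝ)..s', (Ψ N s z i).2)) → let P : (N : ℕ) → Measure (Config (N + 1) (Fin 3) T3) := fun N => volume.withDensity (fun z => ENNReal.ofReal (canonicalDensity (Torus.geometry (Fin 3))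 0 (N + 1) (localGibbsProfile a₀ u₀ θ₀) z)); (∀ N, IsProbabilityMeasure (P N)) → (∀ χ' : T3 → ℝ, Continuous χ' → ∀ δ' : ℝ, 0 < δ' → Tendsto (fun N => P N {z | δ' < |empiricalDensityField z χ' - ∫ x, χ' x * ρ 0 x|}) atTop (𝓝 0) ∧ Tendsto (fun N => P N {z | δ' < ‖empiricalMomentumField z χ' - ∫ x, (χ' x * ρ 0 x) • u 0 x‖}) atTop (𝓝 0) ∧ Tendsto (fun N => P N {z | δ' < |empiricalEnergyField z χ' - ∫ x, χ' x * totalEnergyDensity (ρ 0 x) (u 0 x) (θ 0 x)|}) atTop (𝓝 0)) → limsup (fun N => P N {z | δ < |empiricalDensityField (Ψ N t z) χ - ∫ x, χ x * ρ t x|}) atTop ≤ ENNReal.ofReal δ ∧ limsup (fun N => P N {z | δ < ‖empiricalMomentumField (Ψ N t z) χ - ∫ x, (χ x * ρ t x) • u t x‖}) atTop ≤ ENNReal.ofReal δ ∧ limsup (fun N => P N {z | δ < |empiricalEnergyField (Ψ N t z) χ - ∫ x, χ x * totalEnergyDensity (ρ t x) (u t x) (θ t x)|}) atTop ≤ ENNReal.ofReal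 δ

-- item stmt-AtomisticToContinuum-6935 · crux · rank 6 · closed · moot by None · by planner — informal only, no Lean statement yet:
--   [crux] DIAL CONTINUITY = the fixed-height rungs R2 (card W5): for every FIXED shoulder height v =
--   V_0/theta in (0, infinity) — square shoulder V_0 1(r < eps_N) (SquareShoulderFlow, D2) or the C^2
--   bump of the typed rungs — and sigma < sigma_0(profiles, v), the fixed-reduced-density Euler limit
--   holds EXACTLY with the penetrable-sphere equation of state p = rho theta Z_v(rho sigma^3) and
--   internal energy 3 theta/2 + potential part (IsPairPotentialEulerSolution, D3), for
--   shoulder-local-Gibbs data, in probability, before the first shock. v -> 0+ matches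
--   SmallHeightAccuracy (Z_v = 1 + O(v rho sigma^3

/-- item stmt-AtomisticToContinuum-5483 · support · rank 9 · closed · moot by None · by planner
sources: KestenPapanicolaou1980, KomorowskiRyzhik2006, doi:10.1039/c9sm00442d, Catapano2018
[support] CALIBRATION THEOREM (card R0-Lorentz / W4, Kesten–Papanicolaou at positive scatterer
volume fraction in the Euler window). One particle from (x₀, v₀ ≠ 0) among N+1 i.i.d. uniform FROZEN
bump scatterers h_N ψ(|x − c_k|/ε_N) on 𝕋³, ε_N = hsDiameter σ N, σ < 1/2, window heights: at every
fixed t > 0, annealed over the scatterers, the speed → |v₀| and the position → x₀ in probability,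
and the law of the velocity becomes asymptotically invariant under every linear isometry of ℝ³
(uniform on the sphere |v| = |v₀|). Bookkeeping: relaxation time τ ≍ N^(-1/3)h⁻², explored radius ≍
N^(-1/6)h⁻¹ → 0 containing ≍ N^(1/2)h⁻³ → ∞ scatterers (⇔ window), re-encounter fraction ≍
N^(-1/6)h³ → 0. Stochastic-acceleration technology (KestenPapanicolaou1980 d ≥ 3;
KomorowskiRyzhik2006 for t ≫ kinetic time) in a joint small-scatterer limit; the one-body half of
WindowEuler's local equilibration. [difficulty: L] -/
@[route_item "route-AtomisticToContinuum-SoftShoulderLandauDial"]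
def SoftLorentzIsotropisation : Prop :=
  open Literature.MathematicalPhysics.KineticTheory Literature.Analysis.FluidPDE in ∀ (ψ : ℝ → ℝ), ContDiff ℝ 2 ψ → Antitone ψ → (∀ r, r ≤ 2⁻¹ → ψ r = 1) → (∀ r, 1 ≤ r → ψ r = 0) → ∀ (h : ℕ → ℝ), (∀ N, 0 < h N) → Tendsto h atTop (𝓝 0) → Tendsto (fun N => h N * ((N + 1 : ℕ) : ℝ) ^ (6 : ℝ)⁻¹) atTop atTop → ∀ σ : ℝ, 0 < σ → σ < 2⁻¹ → ∀ (x₀ : T3) (v₀ : V3), v₀ ≠ 0 → ∀ (X : (N : ℕ) → (Fin (N + 1) → T3) → ℝ → T3) (V : (N : ℕ) → (Fin (N + 1) → T3) → ℝ → V3), (∀ (N : ℕ) (c : Fin (N + 1) → T3), V N c 0 = v₀ ∧ ∀ t : ℝ, HasDerivAt (V N c) (-∑ k, gradient (fun x : V3 => h N * ψ (‖x‖ / hsDiameter σ N)) ((Torus.geometry (Fin 3)).sepVec (X N c t) (c k))) t ∧ X N c t = (Torus.geometry (Fin 3)).translate x₀ (∫ s in (0 : ℝ)..t, V N c s)) →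 let Q : (N : ℕ) → Measure (Fin (N + 1) → T3) := fun N => Measure.pi (fun _ : Fin (N + 1) => (volume : Measure T3)); ∀ t : ℝ, 0 < t → (∀ δ : ℝ, 0 < δ → Tendsto (fun N => Q N {c | δ < |‖V N c t‖ - ‖v₀‖|}) atTop (𝓝 0) ∧ Tendsto (fun N => Q N {c | δ < ‖(Torus.geometry (Fin 3)).sepVec (X N c t) x₀‖}) atTop (𝓝 0)) ∧ ∀ (g : BoundedContinuousFunction V3 ℝ) (R : V3 ≃ₗᵢ[ℝ] V3), Tendsto (fun N => (∫ c, g (V N c t) ∂Q N) - ∫ c, g (R (V N c t)) ∂Q N) atTop (𝓝 0)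

-- item stmt-AtomisticToContinuum-6948 · support · rank 9 · closed · moot by None · by planner — informal only, no Lean statement yet:
--   [support] FAR-END IDENTITY (top rung = conjunct pathwise). For the square-shoulder flow
--   (SquareShoulderFlow, D2) of N+1 spheres of range eps_N = hsDiameter sigma N with height V_0,N >=
--   (N+1)^2 (any height exceeding the total kinetic energy on the event below), started from the
--   HARD-SPHERE local Gibbs law localGibbsLaw sigma a_0 u_0 theta_0 (no initial overlaps): on the event
--   {total kinetic energy <= (N+1)^(3/2)} — probability -> 1 by the LLN at t = 0 and conservation — no
--   pair ever has normal relative energy >= V_0,N, so no refraction occurs and the shoulder trajectory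
--   coincides with the hard-

-- item stmt-AtomisticToContinuum-6950 · support · rank 9 · closed · moot by None · by planner — informal only, no Lean statement yet:
--   [support] STATICS AND KINETICS OF THE SHOULDER GAS (card W3; home of cheapest falsifiers (i)-(ii)).
--   (a) Cluster expansion / LLN for shoulder local Gibbs laws uniformly in V_0 in [0, infinity] at small
--   rho sigma^3 (Ruelle1969 Ch. 4 with |e^(-beta V) - 1| <= 1; B_2 = (2 pi/3) eps^3 (1 -
--   e^(-V_0/theta))), Z_v analytic at small density; (b) the penetrable-sphere Boltzmann(-Enskog)
--   collision kernel (Santos2005): refraction in/out above the normal-energy threshold V_0, specular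
--   reflection below; flux-weighted probability of reflection / near-critical transmission O(v), kicks
--   <= 2 (v theta)^(1/2), tr

-- earlier Assembly (stmt-AtomisticToContinuum-5484, replaced 2026-08-15T12:07:06Z -> stmt-AtomisticToContinuum-7294): retired by None — DialEuler → Literature.MathematicalPhysics.KineticTheory.HydrodynamicLimit
/-- item stmt-AtomisticToContinuum-7294 · assembly · rank 1 · closed · moot by None · by planner
sources: Spohn1991, OllaVaradhanYau1993
[assembly] DialEuler → HydrodynamicLimit (projection; the rungs WindowEuler,
EquilibriumDecorrelation, SmallHeightAccuracy, SoftLorentzIsotropisation are evidence toward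
DialEuler, not antecedents). -/
@[route_item "route-AtomisticToContinuum-SoftShoulderLandauDial"]
def Assembly : Prop :=
  WindowEuler → DialEuler → Literature.MathematicalPhysics.KineticTheory.HydrodynamicLimit

end Summit.AtomisticToContinuum.HydrodynamicLimit.Theses.SoftShoulderLandauDial
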